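import Summits.PneNP.PneNP.Theorems.ChebyshevTracialDesignMatchingClosedSums
import HarnessLib

/-!
# Cell pnp-psdrank, route `ChebyshevTracialDesign`: the tight relation factors through the closed sets —
# column sums of a harmonic layer over the tight cuts of a perfect matching

Harmonic backbone, brick 5a (MEMO-7 §1 (1a)+(1b)+(1e) assembled for the tight level). With a perfect matching encoded
by its fixed-point-free partner involution `π`, a cut `U` is TIGHT (`|δ(U) ∩ M| = 1`) iff exactly one point of `U` has
its partner outside `U`; equivalently (`card_filter_erase_closed`) iff `U` has a `π`-closed subset of size `|U| − 1`,
which is then unique — Rothvoß's tight pairs are "closed set plus one point" [cite: Rothvoss2017, §2 (PDF p. 6)]. Hence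
sums over the tight `(m+1)`-cuts factor through the closed `m`-sets (`tightSum_eq_closedSum_supersets`), and for the
layer function `zeta p` of a Johnson-harmonic `p` of degree `k` the slice ladder (p437052) and the `B`-scalar
(`…MatchingClosedSums`) give the TIGHT COLUMN SUMS in closed form:
* `tightSum_zeta_eq_zero_of_odd` : `Σ_{U tight, |U| = 2a+1} zeta p (U) = 0` for odd `k`;
* `tightSum_zeta_eq_of_even` : `= (n − 2a − 2κ) · C(n/2 − 2κ, a − κ) · Σ_{T closed, |T| = 2κ} p_T` for `k = 2κ`
  (`4κ ≤ n`, `κ ≤ a`).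
This is `A_1ᵀ(zeta p) = σ̃_k(1)·Π_p` of MEMO-7 (★): the tight incidence kills the odd Johnson layers of the cut side and
maps each even layer onto one matching-side vector [cite: GodsilMeagher2015, §15.2 (perfect matching scheme)]. WHAT THIS IS
NOT: the eigenvalues (★★) need one more evaluation (the dipole test vector), and the Hoffman bound; nothing on psd rank.
Supports crux stmt-PneNP-19878.
-/

set_option linter.dupNamespace false -- `Summit.PneNP.PneNP.…`: summit = sub-problem (D-0017)

noncomputable section

namespace Summit.PneNP.PneNP.Theorems.ChebyshevTracialDesignTightLayerSums

open Finset Literature.Combinatorics.AssociationSchemes Literature.Combinatorics.AssociationSchemes.JohnsonHarmonics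
open Summit.PneNP.PneNP.Theorems.ChebyshevTracialDesignMatchingHarmonics
open Summit.PneNP.PneNP.Theorems.ChebyshevTracialDesignSliceLadders
open Summit.PneNP.PneNP.Theorems.ChebyshevTracialDesignInvolutionKeys
open Summit.PneNP.PneNP.Theorems.ChebyshevTracialDesignMatchingClosedSums

variable {n : ℕ}

/-! ### §1 Tight cuts are the closed sets plus one point -/

/-- `U \ {z}` is `π`-closed iff the points of `U` with partner outside `U` are exactly `{z}`. -/
theorem erase_closed_iff {π : Fin n → Fin n} (hinv : ∀ x, π (π x) = x) (hfix : ∀ x, π x ≠ x)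
    {U : Finset (Fin n)} {z : Fin n} (hz : z ∈ U) :
    (∀ x ∈ U.erase z, π x ∈ U.erase z) ↔ U.filter (fun x => π x ∉ U) = {z} := by
  constructor
  · intro h
    ext x
    simp only [mem_filter, mem_singleton]
    constructor
    · rintro ⟨hxU, hπx⟩
      by_contra hxz
      exact hπx (mem_of_mem_erase (h x (mem_erase.2 ⟨hxz, hxU⟩)))
    · rintro rfl
      refine ⟨hz, fun hπz => ?_⟩
      -- `π z ∈ U`, `π z ≠ z`, so `π z ∈ U \ z` and then `z = π (π z) ∈ U \ z`: contradiction
      have h1 : π x ∈ U.erase x := mem_erase.2 ⟨hfix x, hπz⟩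
      have h2 := h _ h1
      rw [hinv] at h2
      exact (notMem_erase x U) h2
  · intro h x hx
    obtain ⟨hxz, hxU⟩ := mem_erase.1 hx
    have hπxU : π x ∈ U := by
      by_contra hout
      have : x ∈ U.filter (fun x => π x ∉ U) := mem_filter.2 ⟨hxU, hout⟩
      rw [h, mem_singleton] at this
      exact hxz this
    refine mem_erase.2 ⟨fun hπxz => ?_, hπxU⟩
    -- `π x = z`: then `z`'s partner `x` lies in `U`, contradicting `π z ∉ U`
    have hzout : π z ∉ U := by
      have : z ∈ U.filter (fun x => π x ∉ U) := by rw [h]; exact mem_singleton_self z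
      exact (mem_filter.1 this).2
    apply hzout
    rw [← hπxz, hinv]; exact hxU

/-- **Tight ⟺ a unique closed co-point subset.** The number of `z ∈ U` with `U \ {z}` closed is `1` if exactly one
point of `U` has its partner outside `U` (the cut is tight), and `0` otherwise. -/
theorem card_filter_erase_closed {π : Fin n → Fin n} (hinv : ∀ x, π (π x) = x) (hfix : ∀ x, π x ≠ x)
    (U : Finset (Fin n)) :
    ((U.filter fun z => ∀ x ∈ U.erase z, π x ∈ U.erase z).card : ℝ) =
      if (U.filter (fun x => π x ∉ U)).card = 1 then 1 else 0 := by
  classical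
  have hset : U.filter (fun z => ∀ x ∈ U.erase z, π x ∈ U.erase z) =
      U.filter (fun z => U.filter (fun x => π x ∉ U) = {z}) :=
    filter_congr fun z hz => erase_closed_iff hinv hfix hz
  rw [hset]
  split_ifs with h
  · obtain ⟨z₀, hz₀⟩ := card_eq_one.1 h
    have hz₀U : z₀ ∈ U := by
      have : z₀ ∈ U.filter (fun x => π x ∉ U) := by rw [hz₀]; exact mem_singleton_self _
      exact (mem_filter.1 this).1
    have : U.filter (fun z => U.filter (fun x => π x ∉ U) = {z}) = {z₀} := by
      ext z
      simp only [mem_filter, mem_singleton, hz₀, singleton_inj]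
      constructor
      · rintro ⟨-, h'⟩; exact h'.symm
      · rintro rfl; exact ⟨hz₀U, rfl⟩
    rw [this, card_singleton, Nat.cast_one]
  · rw [Nat.cast_eq_zero, card_eq_zero, filter_eq_empty_iff]
    intro z _ hz
    exact h (by rw [hz, card_singleton])

/-- **Sums over tight cuts factor through the closed sets**: for any `f`,
`Σ_{|U| = m+1, U tight} f(U) = Σ_{V closed, |V| = m} Σ_{U ⊇ V, |U| = m+1} f(U)`. -/
theorem tightSum_eq_closedSum_supersets {π : Fin n → Fin n} (hinv : ∀ x, π (π x) = x) (hfix : ∀ x, π x ≠ x)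
    (f : Finset (Fin n) → ℝ) (m : ℕ) :
    ∑ U ∈ (powersetCard (m + 1) (univ : Finset (Fin n))).filter (fun U => (U.filter (fun x => π x ∉ U)).card = 1), f U =
      ∑ V ∈ (powersetCard m (univ : Finset (Fin n))).filter (fun V => ∀ x ∈ V, π x ∈ V),
        ∑ U ∈ (powersetCard (V.card + 1) (univ : Finset (Fin n))).filter (fun U => V ⊆ U), f U := by
  classical
  -- rewrite the inner index set uniformly (`V.card = m` on the outer range) and swap
  have hinner : ∀ V ∈ (powersetCard m (univ : Finset (Fin n))).filter (fun V => ∀ x ∈ V, π x ∈ V),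
      ∑ U ∈ (powersetCard (V.card + 1) (univ : Finset (Fin n))).filter (fun U => V ⊆ U), f U =
      ∑ U ∈ (powersetCard (m + 1) (univ : Finset (Fin n))).filter (fun U => V ⊆ U), f U := by
    intro V hV
    rw [(mem_powersetCard.1 (mem_filter.1 hV).1).2]
  rw [sum_congr rfl hinner,
    sum_comm' (t' := powersetCard (m + 1) (univ : Finset (Fin n)))
      (s' := fun U => ((powersetCard m (univ : Finset (Fin n))).filter (fun V => ∀ x ∈ V, π x ∈ V)).filter
        (fun V => V ⊆ U))
      (h := fun V U => by simp only [mem_filter, mem_powersetCard, subset_univ, true_and]; tauto)]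
  -- now both sides are sums over `U`; compare the weights
  rw [sum_filter]
  refine sum_congr rfl fun U hU => ?_
  have hUc : U.card = m + 1 := (mem_powersetCard.1 hU).2
  rw [sum_const, nsmul_eq_mul]
  -- the closed `m`-subsets of `U` are the closed co-point subsets `U \ z`
  have hcount : ((((powersetCard m (univ : Finset (Fin n))).filter (fun V => ∀ x ∈ V, π x ∈ V)).filter
      (fun V => V ⊆ U)).card : ℝ) = ((U.filter fun z => ∀ x ∈ U.erase z, π x ∈ U.erase z).card : ℝ) := by
    congr 1
    have hset : ((powersetCard m (univ : Finset (Fin n))).filter (fun V => ∀ x ∈ V, π x ∈ V)).filter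
        (fun V => V ⊆ U) = (U.filter fun z => ∀ x ∈ U.erase z, π x ∈ U.erase z).image (fun z => U.erase z) := by
      ext V
      simp only [mem_filter, mem_powersetCard, subset_univ, true_and, mem_image]
      constructor
      · rintro ⟨⟨hVm, hcl⟩, hVU⟩
        have h1 : (U \ V).card = 1 := by rw [card_sdiff_of_subset hVU, hUc, hVm]; simp
        obtain ⟨z, hz⟩ := card_eq_one.1 h1
        have hzU : z ∈ U \ V := by rw [hz]; exact mem_singleton_self z
        have hVeq : U.erase z = V := by
          ext x
          simp only [mem_erase]
          constructor
          · rintro ⟨hxz, hxU⟩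
            by_contra hxV
            have : x ∈ U \ V := mem_sdiff.2 ⟨hxU, hxV⟩
            rw [hz, mem_singleton] at this
            exact hxz this
          · intro hx
            exact ⟨fun h => (mem_sdiff.1 hzU).2 (h ▸ hx), hVU hx⟩
        refine ⟨z, ⟨(mem_sdiff.1 hzU).1, by rw [hVeq]; exact hcl⟩, hVeq⟩
      · rintro ⟨z, ⟨hzU, hcl⟩, rfl⟩
        exact ⟨⟨by rw [card_erase_of_mem hzU, hUc]; simp, hcl⟩, erase_subset z U⟩
    rw [hset, card_image_of_injOn]
    intro z hz z' hz' h
    exact erase_injOn U (mem_filter.1 (mem_coe.1 hz)).1 (mem_filter.1 (mem_coe.1 hz')).1 h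
  rw [hcount, card_filter_erase_closed hinv hfix U]
  split_ifs <;> simp

/-! ### §2 Tight column sums of a harmonic layer -/

/-- **Odd layers are invisible to the tight relation.** For a fixed-point-free involution `π` (a perfect matching)
and a Johnson-harmonic `p` of odd degree `k`: `Σ_{U tight, |U| = 2a+1} zeta p (U) = 0`. -/
theorem tightSum_zeta_eq_zero_of_odd {π : Fin n → Fin n} (hinv : ∀ x, π (π x) = x) (hfix : ∀ x, π x ≠ x)
    {k : ℕ} (hk : Odd k) {p : Finset (Fin n) → ℝ} (hp : IsHarmonic k p) (a : ℕ) :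
    ∑ U ∈ (powersetCard (2 * a + 1) (univ : Finset (Fin n))).filter (fun U => (U.filter (fun x => π x ∉ U)).card = 1),
      zeta p U = 0 := by
  rw [tightSum_eq_closedSum_supersets hinv hfix]
  have hinner : ∀ V ∈ (powersetCard (2 * a) (univ : Finset (Fin n))).filter (fun V => ∀ x ∈ V, π x ∈ V),
      ∑ U ∈ (powersetCard (V.card + 1) (univ : Finset (Fin n))).filter (fun U => V ⊆ U), zeta p U =
      ((n : ℝ) - (2 * a : ℕ) - k) * zeta p V := by
    intro V hV
    rw [sum_supersets_zeta hp V, (mem_powersetCard.1 (mem_filter.1 hV).1).2]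
  rw [sum_congr rfl hinner, ← mul_sum, closedSum_zeta_eq_zero_of_odd hinv hfix hk hp a, mul_zero]

/-- **Tight column sums in even degree.** For a fixed-point-free involution `π` of `Fin n`, a Johnson-harmonic `p` of
degree `2κ` (`4κ ≤ n`) and `κ ≤ a`:
`Σ_{U tight, |U| = 2a+1} zeta p (U) = (n − 2a − 2κ) · C(n/2 − 2κ, a − κ) · Σ_{T closed, |T| = 2κ} p_T`. -/
theorem tightSum_zeta_eq_of_even {π : Fin n → Fin n} (hinv : ∀ x, π (π x) = x) (hfix : ∀ x, π x ≠ x)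
    {κ : ℕ} (hκn : 4 * κ ≤ n) {p : Finset (Fin n) → ℝ} (hp : IsHarmonic (2 * κ) p) {a : ℕ} (hκa : κ ≤ a) :
    ∑ U ∈ (powersetCard (2 * a + 1) (univ : Finset (Fin n))).filter (fun U => (U.filter (fun x => π x ∉ U)).card = 1),
      zeta p U =
      ((n : ℝ) - (2 * a : ℕ) - (2 * κ : ℕ)) *
        ((((((univ : Finset (Fin n)).filter (fun x => x < π x)).card - 2 * κ).choose (a - κ) : ℕ) : ℝ) *
          ∑ T ∈ univ.filter (fun T : Finset (Fin n) => (T.filter (fun x => π x ∈ T)).card = 2 * κ), p T) := by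
  rw [tightSum_eq_closedSum_supersets hinv hfix]
  have hinner : ∀ V ∈ (powersetCard (2 * a) (univ : Finset (Fin n))).filter (fun V => ∀ x ∈ V, π x ∈ V),
      ∑ U ∈ (powersetCard (V.card + 1) (univ : Finset (Fin n))).filter (fun U => V ⊆ U), zeta p U =
      ((n : ℝ) - (2 * a : ℕ) - (2 * κ : ℕ)) * zeta p V := by
    intro V hV
    rw [sum_supersets_zeta hp V, (mem_powersetCard.1 (mem_filter.1 hV).1).2]
  rw [sum_congr rfl hinner, ← mul_sum, closedSum_zeta_eq_of_even hinv hfix hκn hp hκa]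

end Summit.PneNP.PneNP.Theorems.ChebyshevTracialDesignTightLayerSums
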